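/-
Copyright (c) 2026 the pub-hodgecm-mathlib formalisation cell (harness21).  Prover seat hodgecm-mathlib-B-p10 (g27), 2026-09-01.  Road «W′» = «R1LL-WILD»
((W′-B6) sub-socket (B6-V), brick (V-deep)): the `hvα`-FREE heads (ask of the (B6-V) HEAD holder F0P3a-p08 (g16), 13:08:58Z).
-/
import Literature.NumberTheory.Rogawski1990.RankOneKappaShellAverageDeep   -- ★ p844449 (this seat): (V-deep) under `hvα`; brings ★ p844429 FILE A, ★ p844282, the `H_v` carriers
import HarnessLib

/-!
# (V-deep) «DEEP SHELL AVERAGES AGREE» for ANY anti-fixed `α ≠ 0` — the depth absorbs `max(|α|, |α|⁻¹)`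

Topic `NumberTheory/Rogawski1990`; namespace `Literature.NumberTheory.Rogawski1990`.  THEOREMS ONLY (no definition, no named fact, no instance, no notation,
no `sorry`; net debt 0).  Cell `pub/hodgecm-mathlib`, F0∕P3a, crux H413 = `stmt-HodgeConjecture-24833`, road «W′» = «R1LL-WILD», (B6-V) HEAD `exists_wildValueLaws`
(holder F0P3a-p08 (g16)): the (W′-B6) CLOSE binders (v4 9faab2c8) carry only `(hα : σ_w α = −α) (hα0 : α ≠ 0)` — `α` is pinned by `hK` — so the HEAD cannot assume
`|α|_w ∈ {1, |ϖ_w|}`; this file re-keys ★ p844449's two heads WITHOUT `hvα` (only `hα0`).  Seat B-p10 (g27).  HONEST LABEL: HC_CM is proved only modulo the printed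
citations (2 remaining named inputs hLiu418, h413) until rung 0 closes; nothing printed is asserted here.

THE CHANGE.  With `|α| = exp(n)`, the `diag(1,α)`-twist costs at most `max(|α|, |α|⁻¹) = exp|n|` (`forall_v_diagonal_twist_sub_one_le'`), so the depth of ★ p844449
becomes `j := j₀ + |n| + 1` instead of `j₀ + 1`; everything else (uniform right-smoothness ★ `exists_nhds_one_forall_mul_eq_of_hasCompactSupport`, conjugation tube ★
`exists_nhds_one_forall_conj_mem`, descent of the quotient ★ `descent_inv_mul_eq_map`, congruence of quotients ★ `forall_v_inv_mul_sub_one_le`, depth ★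
`exists_depth_mem_of_mem_nhds_one`) is as in ★ p844449.

* `forall_v_diagonal_twist_sub_one_le'` (any valued field, any `α ≠ 0`).
* **`exists_depth_setIntegral_conj_prod_eq_of_descent_congr'`** (pair form), **`exists_depth_shellAverage_eq_of_descent_congr'`** (the `fbar` literal) — conclusion `∃ j, 0 < j ∧ ∀ …` (the depth is ≥ 1), binders
  `(L v w hw) (hα0) (ν) (f) (hf) (K) (hKo) (hKc) (E₂)` — NB the ORDER (`hα0` early, `K` before `E₂`): the gate's `dedup.landed` key otherwise confuses these heads with ★ p844449's.

## References
* [LabesseLanglands1979] J.-P. Labesse, R. P. Langlands, *L-indistinguishability for SL(2)*, Canad. J. Math. 31 (1979) 726–785: §2 (2.1)–(2.2), pp. 8–9.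
* [Labesse2024StabilisationGermesSL2] J.-P. Labesse, *Stabilisation et germes pour SL(2) en toutes caractéristiques*, arXiv:2411.14820: Prop. 0.0.11, Th. 0.0.12.
* [Rogawski1990] J. D. Rogawski, *Automorphic Representations of Unitary Groups in Three Variables*, Ann. of Math. Stud. 123 (1990): §4.9 Lemma 4.9.3 p. 56.
-/

set_option autoImplicit false

noncomputable section

open scoped Matrix ValuativeRel MatrixGroups Topology WithZero
open Matrix ValuativeRel MeasureTheory NumberField IsDedekindDomain Filter Set

namespace Literature.NumberTheory.Rogawski1990

open Literature.NumberTheory.Automorphic Literature.NumberTheory.Automorphic.UnitaryGroup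

/-! ## The `hvα`-FREE HEADS — any anti-fixed `α ≠ 0`; the depth absorbs `|α|^{±1}` (ask of the (B6-V) HEAD holder F0P3a-p08 (g16), 13:08:58Z:
the (W′-B6) CLOSE binders carry only `(hα : σ_w α = −α) (hα0 : α ≠ 0)`, `α` being pinned by `hK`) -/

section TwistAnyAlpha

variable {K : Type*} [Field K] {Γ₀ : Type*} [LinearOrderedCommGroupWithZero Γ₀] [hK : Valued K Γ₀]

/-- **THE `diag(1,α)`-TWIST COSTS AT MOST `max(|α|, |α|⁻¹)`** (any `α ≠ 0`): if `M ≡ 1` modulo valuation `≤ ρ` entrywise then `diag(1,α⁻¹)·M·diag(1,α) ≡ 1` modulo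
`≤ ρ·max(|α|, |α|⁻¹)`. [cite: LabesseLanglands1979, §2 p. 8] -/
theorem forall_v_diagonal_twist_sub_one_le' {α : K} (hα0 : α ≠ 0) (M : Matrix (Fin 2) (Fin 2) K) {ρ : Γ₀}
    (h : ∀ i k, Valued.v ((M - 1) i k) ≤ ρ) :
    ∀ i k, Valued.v ((Matrix.diagonal ![1, α⁻¹] * M * Matrix.diagonal ![1, α] - 1) i k) ≤ ρ * max (Valued.v α) (Valued.v α)⁻¹ := by
  have hvα0 : Valued.v α ≠ 0 := (Valuation.ne_zero_iff _).2 hα0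
  have hvαpos : 0 < Valued.v α := zero_lt_iff.2 hvα0
  have hMge : 1 ≤ max (Valued.v α) (Valued.v α)⁻¹ := by
    rcases le_or_gt (Valued.v α) 1 with h1 | h1
    · exact le_max_of_le_right ((one_le_inv₀ hvαpos).2 h1)
    · exact le_max_of_le_left h1.le
  have hone : (![(1 : K), α⁻¹] : Fin 2 → K) = ![(1 : K)⁻¹, α⁻¹] := by rw [inv_one]
  have hconj1 : Matrix.diagonal ![1, α⁻¹] * (1 : Matrix (Fin 2) (Fin 2) K) * Matrix.diagonal ![1, α] = 1 := by
    rw [Matrix.mul_one]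
    exact Literature.NumberTheory.Automorphic.UnitaryGroup.diagonal_inv_mul_diagonal hα0
  have h0 : (![(1 : K)⁻¹, α⁻¹] : Fin 2 → K) 0 = 1 := by simp
  have h1 : (![(1 : K)⁻¹, α⁻¹] : Fin 2 → K) 1 = α⁻¹ := by simp
  have h0' : (![(1 : K), α] : Fin 2 → K) 0 = 1 := by simp
  have h1' : (![(1 : K), α] : Fin 2 → K) 1 = α := by simp
  intro i k
  have hentry : (Matrix.diagonal ![1, α⁻¹] * M * Matrix.diagonal ![1, α] - 1) i k = (![(1 : K)⁻¹, α⁻¹] i) * (M - 1) i k * (![1, α] k) := by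
    have hsub : Matrix.diagonal ![1, α⁻¹] * M * Matrix.diagonal ![1, α] - 1 = Matrix.diagonal ![1, α⁻¹] * (M - 1) * Matrix.diagonal ![1, α] := by
      rw [Matrix.mul_sub, Matrix.sub_mul, hconj1]
    rw [hsub, hone]
    exact LocalFields.QuadraticRegularRep.diagonal_inv_mul_mul_diagonal_apply 1 α (M - 1) i k
  rw [hentry, map_mul, map_mul]
  fin_cases i <;> fin_cases k
  · rw [Fin.zero_eta, h0, h0', map_one, one_mul, mul_one]
    exact (h 0 0).trans (le_mul_of_one_le_right' hMge)
  · rw [Fin.zero_eta, Fin.mk_one, h0, h1', map_one, one_mul]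
    exact mul_le_mul' (h 0 1) (le_max_left _ _)
  · rw [Fin.zero_eta, Fin.mk_one, h1, h0', map_one, mul_one, map_inv₀, mul_comm]
    exact mul_le_mul' (h 1 0) (le_max_right _ _)
  · rw [Fin.mk_one, h1, h1', map_inv₀, mul_assoc, mul_comm (Valued.v ((M - 1) 1 1)), ← mul_assoc, inv_mul_cancel₀ hvα0, one_mul]
    exact (h 1 1).trans (le_mul_of_one_le_right' hMge)

end TwistAnyAlpha

section DeepAnyAlpha


variable (L : Type) [Field L] [NumberField L] [IsCMField L] (v : HeightOneSpectrum (𝓞 ↥(maximalRealSubfield L)))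
  (w : PlacesOver L v) (hw : IsCMField.complexConj L • w.1 = w.1) {α : w.1.adicCompletion L} (hα0 : α ≠ 0)
  [MeasurableSpace ((cmDatum L 2 (Matrix.of fun i j : Fin 2 => if i.val + j.val + 1 = 2 then (1 : L) else 0)).Local v × (cmDatum L 1 (Matrix.of fun i j : Fin 1 => if i.val + j.val + 1 = 1 then (1 : L) else 0)).Local v)]
  [BorelSpace ((cmDatum L 2 (Matrix.of fun i j : Fin 2 => if i.val + j.val + 1 = 2 then (1 : L) else 0)).Local v × (cmDatum L 1 (Matrix.of fun i j : Fin 1 => if i.val + j.val + 1 = 1 then (1 : L) else 0)).Local v)]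
  (ν : Measure ((cmDatum L 2 (Matrix.of fun i j : Fin 2 => if i.val + j.val + 1 = 2 then (1 : L) else 0)).Local v × (cmDatum L 1 (Matrix.of fun i j : Fin 1 => if i.val + j.val + 1 = 1 then (1 : L) else 0)).Local v))
  (f : ((cmDatum L 2 (Matrix.of fun i j : Fin 2 => if i.val + j.val + 1 = 2 then (1 : L) else 0)).Local v × (cmDatum L 1 (Matrix.of fun i j : Fin 1 => if i.val + j.val + 1 = 1 then (1 : L) else 0)).Local v) → ℂ) (hf : IsLocSmooth f)
  (K : Subgroup ((cmDatum L 2 (Matrix.of fun i j : Fin 2 => if i.val + j.val + 1 = 2 then (1 : L) else 0)).Local v))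
  (hKo : IsOpen ((((K.prod (⊤ : Subgroup ((cmDatum L 1 (Matrix.of fun i j : Fin 1 => if i.val + j.val + 1 = 1 then (1 : L) else 0)).Local v))) :
      Subgroup ((cmDatum L 2 (Matrix.of fun i j : Fin 2 => if i.val + j.val + 1 = 2 then (1 : L) else 0)).Local v ×
        (cmDatum L 1 (Matrix.of fun i j : Fin 1 => if i.val + j.val + 1 = 1 then (1 : L) else 0)).Local v))) :
    Set ((cmDatum L 2 (Matrix.of fun i j : Fin 2 => if i.val + j.val + 1 = 2 then (1 : L) else 0)).Local v ×
      (cmDatum L 1 (Matrix.of fun i j : Fin 1 => if i.val + j.val + 1 = 1 then (1 : L) else 0)).Local v)))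
  (hKc : IsCompact ((((K.prod (⊤ : Subgroup ((cmDatum L 1 (Matrix.of fun i j : Fin 1 => if i.val + j.val + 1 = 1 then (1 : L) else 0)).Local v))) :
      Subgroup ((cmDatum L 2 (Matrix.of fun i j : Fin 2 => if i.val + j.val + 1 = 2 then (1 : L) else 0)).Local v ×
        (cmDatum L 1 (Matrix.of fun i j : Fin 1 => if i.val + j.val + 1 = 1 then (1 : L) else 0)).Local v))) :
    Set ((cmDatum L 2 (Matrix.of fun i j : Fin 2 => if i.val + j.val + 1 = 2 then (1 : L) else 0)).Local v ×
      (cmDatum L 1 (Matrix.of fun i j : Fin 1 => if i.val + j.val + 1 = 1 then (1 : L) else 0)).Local v)))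
  (E₂ : (cmDatum L 2 (Matrix.of fun i j : Fin 2 => if i.val + j.val + 1 = 2 then (1 : L) else 0)).Local v ≃ₜ*
    ↥(unitaryGroupOfForm (galAdicCompletionMap (L := L) (IsCMField.complexConj L) hw) (placeForm (Matrix.of fun i j : Fin 2 => if i.val + j.val + 1 = 2 then (1 : L) else 0) w.1)))

include hf hα0 hKo hKc in
/-- **(V-deep), PAIR FORM, ANY ANTI-FIXED `α ≠ 0`** (ED. 2; the `hvα`-free twin of `exists_depth_setIntegral_conj_prod_eq_of_descent_congr` — the depth `j` now also
absorbs `max(|α|, |α|⁻¹)`): past a depth `j = j(f, K, α)` the `K × U(Φ₁)_v`-average only sees the descent matrix modulo `ϖ^j`-congruence to `1`.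
[cite: LabesseLanglands1979, §2 (2.2) p. 9] [cite: Labesse2024StabilisationGermesSL2, Prop. 0.0.11] [cite: Rogawski1990, §4.9 Lemma 4.9.3 p. 56] -/
theorem exists_depth_setIntegral_conj_prod_eq_of_descent_congr' :
    ∃ j : ℕ, 0 < j ∧ ∀ (X X' : ↥(unitaryGroupOfForm (galAdicCompletionMap (L := L) (IsCMField.complexConj L) hw) (placeForm (Matrix.of fun i j : Fin 2 => if i.val + j.val + 1 = 2 then (1 : L) else 0) w.1)))
      (ζ : w.1.adicCompletion L) (S S' : GL (Fin 2) (v.adicCompletion ↥(maximalRealSubfield L))),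
      Matrix.diagonal ![1, α] * ((X : GL (Fin 2) (w.1.adicCompletion L)) : Matrix (Fin 2) (Fin 2) (w.1.adicCompletion L)) * Matrix.diagonal ![1, α⁻¹] =
        ζ • (S : Matrix (Fin 2) (Fin 2) (v.adicCompletion ↥(maximalRealSubfield L))).map (toPlace v w) →
      Matrix.diagonal ![1, α] * ((X' : GL (Fin 2) (w.1.adicCompletion L)) : Matrix (Fin 2) (Fin 2) (w.1.adicCompletion L)) * Matrix.diagonal ![1, α⁻¹] =
        ζ • (S' : Matrix (Fin 2) (Fin 2) (v.adicCompletion ↥(maximalRealSubfield L))).map (toPlace v w) →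
      (∀ i k, Valued.v (((S : Matrix (Fin 2) (Fin 2) (v.adicCompletion ↥(maximalRealSubfield L))) - 1) i k) ≤ WithZero.exp (-(j : ℤ))) →
      (∀ i k, Valued.v (((S' : Matrix (Fin 2) (Fin 2) (v.adicCompletion ↥(maximalRealSubfield L))) - 1) i k) ≤ WithZero.exp (-(j : ℤ))) →
      ∀ a : (cmDatum L 1 (Matrix.of fun i j : Fin 1 => if i.val + j.val + 1 = 1 then (1 : L) else 0)).Local v,
        ∫ k in (((K.prod (⊤ : Subgroup ((cmDatum L 1 (Matrix.of fun i j : Fin 1 => if i.val + j.val + 1 = 1 then (1 : L) else 0)).Local v))) :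
            Subgroup ((cmDatum L 2 (Matrix.of fun i j : Fin 2 => if i.val + j.val + 1 = 2 then (1 : L) else 0)).Local v ×
              (cmDatum L 1 (Matrix.of fun i j : Fin 1 => if i.val + j.val + 1 = 1 then (1 : L) else 0)).Local v)) :
            Set ((cmDatum L 2 (Matrix.of fun i j : Fin 2 => if i.val + j.val + 1 = 2 then (1 : L) else 0)).Local v ×
              (cmDatum L 1 (Matrix.of fun i j : Fin 1 => if i.val + j.val + 1 = 1 then (1 : L) else 0)).Local v)), f (k⁻¹ * (E₂.symm X, a) * k) ∂ν =
        ∫ k in (((K.prod (⊤ : Subgroup ((cmDatum L 1 (Matrix.of fun i j : Fin 1 => if i.val + j.val + 1 = 1 then (1 : L) else 0)).Local v))) :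
            Subgroup ((cmDatum L 2 (Matrix.of fun i j : Fin 2 => if i.val + j.val + 1 = 2 then (1 : L) else 0)).Local v ×
              (cmDatum L 1 (Matrix.of fun i j : Fin 1 => if i.val + j.val + 1 = 1 then (1 : L) else 0)).Local v)) :
            Set ((cmDatum L 2 (Matrix.of fun i j : Fin 2 => if i.val + j.val + 1 = 2 then (1 : L) else 0)).Local v ×
              (cmDatum L 1 (Matrix.of fun i j : Fin 1 => if i.val + j.val + 1 = 1 then (1 : L) else 0)).Local v)), f (k⁻¹ * (E₂.symm X', a) * k) ∂ν := by
  -- (L1) uniform right-smoothness of `f`, uniform smallness of conjugation by the compact `K × U(Φ₁)_v`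
  obtain ⟨W, hW, hfW⟩ := Literature.Topology.exists_nhds_one_forall_mul_eq_of_hasCompactSupport hf.isLocallyConstant hf.hasCompactSupport
  obtain ⟨V, hV, hconj⟩ := exists_nhds_one_forall_conj_mem hKc hW
  -- pull `V` back to `U_w` along `Y ↦ (E₂⁻¹ Y, 1)`
  set ψ : ↥(unitaryGroupOfForm (galAdicCompletionMap (L := L) (IsCMField.complexConj L) hw) (placeForm (Matrix.of fun i j : Fin 2 => if i.val + j.val + 1 = 2 then (1 : L) else 0) w.1)) →
      ((cmDatum L 2 (Matrix.of fun i j : Fin 2 => if i.val + j.val + 1 = 2 then (1 : L) else 0)).Local v ×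
        (cmDatum L 1 (Matrix.of fun i j : Fin 1 => if i.val + j.val + 1 = 1 then (1 : L) else 0)).Local v) := fun Y => (E₂.symm Y, 1) with hψ
  have hψc : Continuous ψ := E₂.symm.continuous.prodMk continuous_const
  have hψ1 : ψ 1 = 1 := by simp only [hψ, map_one]; rfl
  have hV₁ : ψ ⁻¹' V ∈ 𝓝 (1 : ↥(unitaryGroupOfForm (galAdicCompletionMap (L := L) (IsCMField.complexConj L) hw) (placeForm (Matrix.of fun i j : Fin 2 => if i.val + j.val + 1 = 2 then (1 : L) else 0) w.1))) :=
    hψc.continuousAt.preimage_mem_nhds (by rw [hψ1]; exact hV)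
  -- (L3) the quantitative depth
  obtain ⟨j₀, hj₀⟩ := exists_depth_mem_of_mem_nhds_one L w.1 _ hV₁
  -- `|α| = exp n`; the twist costs at most `exp |n|`
  obtain ⟨n, hn⟩ : ∃ n : ℤ, Valued.v α = WithZero.exp n := ⟨_, (WithZero.exp_log ((Valuation.ne_zero_iff Valued.v).2 hα0)).symm⟩
  have hM : max (Valued.v α) (Valued.v α)⁻¹ ≤ WithZero.exp ((n.natAbs : ℕ) : ℤ) := by
    rw [hn, ← WithZero.exp_neg]
    exact max_le (WithZero.exp_le_exp.2 Int.le_natAbs) (WithZero.exp_le_exp.2 (by have h := @Int.le_natAbs (-n); rwa [Int.natAbs_neg] at h))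
  have he0 : v.asIdeal.ramificationIdx' w.1.asIdeal ≠ 0 := by
    haveI := PlacesOver.liesOver w
    exact Ideal.IsDedekindDomain.ramificationIdx'_ne_zero_of_liesOver w.1.asIdeal v.ne_bot
  -- transport of an `exp(−j)`-bound along `ι_w` and through the twist, for `j = j₀ + |n| + 1`
  have hι : ∀ (j : ℕ) (x : v.adicCompletion ↥(maximalRealSubfield L)), Valued.v x ≤ WithZero.exp (-(j : ℤ)) →
      Valued.v (toPlace v w x) ≤ WithZero.exp (-(j : ℤ)) := fun j x hx => by
    rw [valued_toPlace]
    have hx1 : Valued.v x ≤ 1 := hx.trans (by rw [← WithZero.exp_zero, WithZero.exp_le_exp]; omega)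
    exact (pow_le_of_le_one zero_le hx1 he0).trans hx
  refine ⟨j₀ + n.natAbs + 1, by omega, fun X X' ζ S S' hX hX' hS hS' a => ?_⟩
  have hlt : WithZero.exp (-((j₀ + n.natAbs + 1 : ℕ) : ℤ)) < 1 := by rw [← WithZero.exp_zero, WithZero.exp_lt_exp]; omega
  -- (L2) the quotient `Y := X⁻¹ X′` and its inverse are `exp(−j₀)`-close to `1`
  have hbound : ∀ (Y Y' : ↥(unitaryGroupOfForm (galAdicCompletionMap (L := L) (IsCMField.complexConj L) hw) (placeForm (Matrix.of fun i j : Fin 2 => if i.val + j.val + 1 = 2 then (1 : L) else 0) w.1)))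
      (T T' : GL (Fin 2) (v.adicCompletion ↥(maximalRealSubfield L))),
      Matrix.diagonal ![1, α] * ((Y : GL (Fin 2) (w.1.adicCompletion L)) : Matrix (Fin 2) (Fin 2) (w.1.adicCompletion L)) * Matrix.diagonal ![1, α⁻¹] =
        ζ • (T : Matrix (Fin 2) (Fin 2) (v.adicCompletion ↥(maximalRealSubfield L))).map (toPlace v w) →
      Matrix.diagonal ![1, α] * ((Y' : GL (Fin 2) (w.1.adicCompletion L)) : Matrix (Fin 2) (Fin 2) (w.1.adicCompletion L)) * Matrix.diagonal ![1, α⁻¹] =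
        ζ • (T' : Matrix (Fin 2) (Fin 2) (v.adicCompletion ↥(maximalRealSubfield L))).map (toPlace v w) →
      (∀ i k, Valued.v (((T : Matrix (Fin 2) (Fin 2) (v.adicCompletion ↥(maximalRealSubfield L))) - 1) i k) ≤ WithZero.exp (-((j₀ + n.natAbs + 1 : ℕ) : ℤ))) →
      (∀ i k, Valued.v (((T' : Matrix (Fin 2) (Fin 2) (v.adicCompletion ↥(maximalRealSubfield L))) - 1) i k) ≤ WithZero.exp (-((j₀ + n.natAbs + 1 : ℕ) : ℤ))) →
      ∀ i k, Valued.v (((((Y⁻¹ * Y' : ↥(unitaryGroupOfForm (galAdicCompletionMap (L := L) (IsCMField.complexConj L) hw) (placeForm (Matrix.of fun i j : Fin 2 => if i.val + j.val + 1 = 2 then (1 : L) else 0) w.1))) :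
          GL (Fin 2) (w.1.adicCompletion L)) : Matrix (Fin 2) (Fin 2) (w.1.adicCompletion L)) - 1) i k) ≤ WithZero.exp (-(j₀ : ℤ)) := by
    intro Y Y' T T' hY hY' hT hT'
    have hq : Matrix.diagonal ![1, α] * (((Y⁻¹ * Y' : ↥(unitaryGroupOfForm (galAdicCompletionMap (L := L) (IsCMField.complexConj L) hw) (placeForm (Matrix.of fun i j : Fin 2 => if i.val + j.val + 1 = 2 then (1 : L) else 0) w.1))) :
        GL (Fin 2) (w.1.adicCompletion L)) : Matrix (Fin 2) (Fin 2) (w.1.adicCompletion L)) * Matrix.diagonal ![1, α⁻¹] =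
        ((T⁻¹ * T' : GL (Fin 2) (v.adicCompletion ↥(maximalRealSubfield L))) : Matrix (Fin 2) (Fin 2) (v.adicCompletion ↥(maximalRealSubfield L))).map (toPlace v w) := by
      rw [Subgroup.coe_mul, Subgroup.coe_inv]
      exact descent_inv_mul_eq_map (toPlace v w) hα0 hY hY'
    have hYm := eq_diagonal_inv_mul_mul_diagonal_of_descent hα0 hq
    have hTT : ∀ i k, Valued.v (((((T⁻¹ * T' : GL (Fin 2) (v.adicCompletion ↥(maximalRealSubfield L))) : Matrix (Fin 2) (Fin 2) (v.adicCompletion ↥(maximalRealSubfield L))).map (toPlace v w)) - 1) i k) ≤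
        WithZero.exp (-((j₀ + n.natAbs + 1 : ℕ) : ℤ)) := by
      intro i k
      rw [← Matrix.map_one (toPlace v w) (map_zero _) (map_one _), ← Matrix.map_sub (toPlace v w) (map_sub (toPlace v w)), Matrix.map_apply]
      exact hι _ _ (forall_v_inv_mul_sub_one_le hlt hT hT' i k)
    intro i k
    rw [hYm]
    refine (forall_v_diagonal_twist_sub_one_le' hα0 _ hTT i k).trans ?_
    calc WithZero.exp (-((j₀ + n.natAbs + 1 : ℕ) : ℤ)) * max (Valued.v α) (Valued.v α)⁻¹
        ≤ WithZero.exp (-((j₀ + n.natAbs + 1 : ℕ) : ℤ)) * WithZero.exp ((n.natAbs : ℕ) : ℤ) := mul_le_mul_right hM _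
      _ ≤ WithZero.exp (-(j₀ : ℤ)) := by rw [← WithZero.exp_add, WithZero.exp_le_exp]; push_cast; omega
  have hY : X⁻¹ * X' ∈ ψ ⁻¹' V := by
    refine hj₀ _ (hbound X X' S S' hX hX' hS hS') fun i k => ?_
    have h := hbound X' X S' S hX' hX hS' hS i k
    rw [_root_.mul_inv_rev, inv_inv]
    exact h
  -- pointwise equality of the integrands on `K × U(Φ₁)_v`
  refine setIntegral_congr_fun hKo.measurableSet fun k hk => ?_
  have hsplit : ((E₂.symm X', a) : ((cmDatum L 2 (Matrix.of fun i j : Fin 2 => if i.val + j.val + 1 = 2 then (1 : L) else 0)).Local v ×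
      (cmDatum L 1 (Matrix.of fun i j : Fin 1 => if i.val + j.val + 1 = 1 then (1 : L) else 0)).Local v)) = (E₂.symm X, a) * ψ (X⁻¹ * X') := by
    simp only [hψ, Prod.mk_mul_mk, mul_one, ← map_mul, mul_inv_cancel_left]
  show f (k⁻¹ * (E₂.symm X, a) * k) = f (k⁻¹ * (E₂.symm X', a) * k)
  rw [hsplit]
  have hgrp : k⁻¹ * ((E₂.symm X, a) * ψ (X⁻¹ * X')) * k = (k⁻¹ * (E₂.symm X, a) * k) * (k⁻¹ * ψ (X⁻¹ * X') * k) := by group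
  rw [hgrp, hfW _ _ (hconj k hk _ hY)]

include hf hα0 hKo hKc in
/-- **(V-deep), SHELL-AVERAGE FORM, ANY ANTI-FIXED `α ≠ 0`** (ED. 2; the `hvα`-free twin of `exists_depth_shellAverage_eq_of_descent_congr`, keyed to the (W′-B6) CLOSE
binders `(hα0 : α ≠ 0)` only): `fbar r x = fbar r x′` past the depth `j`, for shell elements with the same descent scalar and `ϖ^j`-congruent descent matrices.
[cite: LabesseLanglands1979, §2 (2.2) p. 9] [cite: Labesse2024StabilisationGermesSL2, Prop. 0.0.11] [cite: Rogawski1990, §4.9 Lemma 4.9.3 p. 56] -/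
theorem exists_depth_shellAverage_eq_of_descent_congr' :
    ∃ j : ℕ, 0 < j ∧ ∀ (r : ↥(unitaryGroupOfForm (galAdicCompletionMap (L := L) (IsCMField.complexConj L) hw) (placeForm (Matrix.of fun i j : Fin 2 => if i.val + j.val + 1 = 2 then (1 : L) else 0) w.1)))
      (x x' : ((cmDatum L 2 (Matrix.of fun i j : Fin 2 => if i.val + j.val + 1 = 2 then (1 : L) else 0)).Local v ×
        (cmDatum L 1 (Matrix.of fun i j : Fin 1 => if i.val + j.val + 1 = 1 then (1 : L) else 0)).Local v))
      (ζ : w.1.adicCompletion L) (S S' : GL (Fin 2) (v.adicCompletion ↥(maximalRealSubfield L))),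
      x'.2 = x.2 →
      Matrix.diagonal ![1, α] * (((r⁻¹ * E₂ x.1 * r : ↥(unitaryGroupOfForm (galAdicCompletionMap (L := L) (IsCMField.complexConj L) hw) (placeForm (Matrix.of fun i j : Fin 2 => if i.val + j.val + 1 = 2 then (1 : L) else 0) w.1))) :
          GL (Fin 2) (w.1.adicCompletion L)) : Matrix (Fin 2) (Fin 2) (w.1.adicCompletion L)) * Matrix.diagonal ![1, α⁻¹] =
        ζ • (S : Matrix (Fin 2) (Fin 2) (v.adicCompletion ↥(maximalRealSubfield L))).map (toPlace v w) →
      Matrix.diagonal ![1, α] * (((r⁻¹ * E₂ x'.1 * r : ↥(unitaryGroupOfForm (galAdicCompletionMap (L := L) (IsCMField.complexConj L) hw) (placeForm (Matrix.of fun i j : Fin 2 => if i.val + j.val + 1 = 2 then (1 : L) else 0) w.1))) :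
          GL (Fin 2) (w.1.adicCompletion L)) : Matrix (Fin 2) (Fin 2) (w.1.adicCompletion L)) * Matrix.diagonal ![1, α⁻¹] =
        ζ • (S' : Matrix (Fin 2) (Fin 2) (v.adicCompletion ↥(maximalRealSubfield L))).map (toPlace v w) →
      (∀ i k, Valued.v (((S : Matrix (Fin 2) (Fin 2) (v.adicCompletion ↥(maximalRealSubfield L))) - 1) i k) ≤ WithZero.exp (-(j : ℤ))) →
      (∀ i k, Valued.v (((S' : Matrix (Fin 2) (Fin 2) (v.adicCompletion ↥(maximalRealSubfield L))) - 1) i k) ≤ WithZero.exp (-(j : ℤ))) →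
        ∫ k in (((K.prod (⊤ : Subgroup ((cmDatum L 1 (Matrix.of fun i j : Fin 1 => if i.val + j.val + 1 = 1 then (1 : L) else 0)).Local v))) :
            Subgroup ((cmDatum L 2 (Matrix.of fun i j : Fin 2 => if i.val + j.val + 1 = 2 then (1 : L) else 0)).Local v ×
              (cmDatum L 1 (Matrix.of fun i j : Fin 1 => if i.val + j.val + 1 = 1 then (1 : L) else 0)).Local v)) :
            Set ((cmDatum L 2 (Matrix.of fun i j : Fin 2 => if i.val + j.val + 1 = 2 then (1 : L) else 0)).Local v ×
              (cmDatum L 1 (Matrix.of fun i j : Fin 1 => if i.val + j.val + 1 = 1 then (1 : L) else 0)).Local v)),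
            f (k⁻¹ * ((E₂.symm r, (1 : (cmDatum L 1 (Matrix.of fun i j : Fin 1 => if i.val + j.val + 1 = 1 then (1 : L) else 0)).Local v))⁻¹ * x *
              (E₂.symm r, (1 : (cmDatum L 1 (Matrix.of fun i j : Fin 1 => if i.val + j.val + 1 = 1 then (1 : L) else 0)).Local v))) * k) ∂ν =
        ∫ k in (((K.prod (⊤ : Subgroup ((cmDatum L 1 (Matrix.of fun i j : Fin 1 => if i.val + j.val + 1 = 1 then (1 : L) else 0)).Local v))) :
            Subgroup ((cmDatum L 2 (Matrix.of fun i j : Fin 2 => if i.val + j.val + 1 = 2 then (1 : L) else 0)).Local v ×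
              (cmDatum L 1 (Matrix.of fun i j : Fin 1 => if i.val + j.val + 1 = 1 then (1 : L) else 0)).Local v)) :
            Set ((cmDatum L 2 (Matrix.of fun i j : Fin 2 => if i.val + j.val + 1 = 2 then (1 : L) else 0)).Local v ×
              (cmDatum L 1 (Matrix.of fun i j : Fin 1 => if i.val + j.val + 1 = 1 then (1 : L) else 0)).Local v)),
            f (k⁻¹ * ((E₂.symm r, (1 : (cmDatum L 1 (Matrix.of fun i j : Fin 1 => if i.val + j.val + 1 = 1 then (1 : L) else 0)).Local v))⁻¹ * x' *
              (E₂.symm r, (1 : (cmDatum L 1 (Matrix.of fun i j : Fin 1 => if i.val + j.val + 1 = 1 then (1 : L) else 0)).Local v))) * k) ∂ν := by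
  obtain ⟨j, hj0, hj⟩ := exists_depth_setIntegral_conj_prod_eq_of_descent_congr' L v w hw hα0 ν f hf K hKo hKc E₂
  refine ⟨j, hj0, fun r x x' ζ S S' hx2 hX hX' hS hS' => ?_⟩
  have hx : (E₂.symm r, (1 : (cmDatum L 1 (Matrix.of fun i j : Fin 1 => if i.val + j.val + 1 = 1 then (1 : L) else 0)).Local v))⁻¹ * x *
      (E₂.symm r, (1 : (cmDatum L 1 (Matrix.of fun i j : Fin 1 => if i.val + j.val + 1 = 1 then (1 : L) else 0)).Local v)) = (E₂.symm (r⁻¹ * E₂ x.1 * r), x.2) := by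
    rw [prod_symm_conj_eq L v w hw E₂ r (E₂ x.1) x.2, ContinuousMulEquiv.symm_apply_apply]
  have hx' : (E₂.symm r, (1 : (cmDatum L 1 (Matrix.of fun i j : Fin 1 => if i.val + j.val + 1 = 1 then (1 : L) else 0)).Local v))⁻¹ * x' *
      (E₂.symm r, (1 : (cmDatum L 1 (Matrix.of fun i j : Fin 1 => if i.val + j.val + 1 = 1 then (1 : L) else 0)).Local v)) = (E₂.symm (r⁻¹ * E₂ x'.1 * r), x.2) := by
    rw [prod_symm_conj_eq L v w hw E₂ r (E₂ x'.1) x.2, ContinuousMulEquiv.symm_apply_apply, ← hx2]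
  simp_rw [hx, hx']
  exact hj _ _ ζ S S' hX hX' hS hS' x.2

end DeepAnyAlpha

end Literature.NumberTheory.Rogawski1990

end
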